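import Literature.NumberTheory.Rogawski1990.LocalTransferChartRealisationStable   -- ★ p840171∕p840239 F0P2-p02 (g8): `exists_transfer_of_boxes_of_realisation`, `exists_mem_mk_eq_of_classOrbitalIntegral_ne_zero`
import HarnessLib

/-!
# The MATCHED CHART of the (HLOC) junction: transfer of `ψ` supported in one regular `G′`-chart whose torus is the transport `θ(T_H)` of an `H`-torus, with the
# `k` RE-SELECTION boxes `w_j(T_H)` on the `H`-side (Rogawski 1990 §4.3 (4.3.1)–(4.3.2), §4.9; Langlands–Shelstad 1987 §1.3)

Topic `NumberTheory/Rogawski1990`; namespace `Literature.NumberTheory.Rogawski1990`.  THEOREMS ONLY (no definition, no instance, no notation, no named fact, no `sorry`);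
GENERIC (abstract «`H`» = `Acar`, «`G′`» = `Bcar`, matching `R`, stable conjugacy `stA`, regularity `regA`, transfer factor `T`, orbital measure families).  Cell `pub/hodgecm-mathlib`
(D-0151), crux H413 = stmt-HodgeConjecture-24833, F0∕P3a road «D-N6-ns», floor-2 letter N6-ns-reg; the GENERIC CORE of the ONE junction file `LocalTransferChartJunctionCM.lean`
(LEAD F0P3a-plan (g9) T8-25 (B)); seat F0P2-p02 (g8); ledger F0P3a-p08 (g13) `LEDGER-N6ns-floor1` cc0e73ef (J-c)(J-d).  HONEST LABEL: HC_CM is proved only modulo the printed citations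
until rung 0 closes; this file proves no letter.

THE MATHEMATICS (the (J-d) correction: the norm fibre of a `G′`-regular stable class has `k ≤ [W_G : W_H]` `H`-stable classes).  A torus coordinate space `Tc` (at CM: the centraliser
`T_H = Z_H(γH₀)` of a `G`-regular `γH₀`), RE-SELECTION maps `τ_j : Tc → H` (`j ∈ J` finite; at CM `t ↦ w_j t`, the `[W_G(T) : W_H(T)] ≤ 3` eigen-slot permutations), a TRANSPORT
`θ : Tc → G′` (at CM `t ↦ x ι(t) x⁻¹ ∈ Z_{G′}(γ₀′)`), a `G′`-chart `e_G(a, b) = s_G(a) θ(b) s_G(a)⁻¹` on a compact open box `K_G × B_G`, and `ψ ∈ C_c^∞(G′)` vanishing off `e_G(K_G × B_G)`.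
Hypotheses (all binders; at CM each is a named ★∕feeder): (N1) DIAGONAL MATCHING on the box `R (τ_j b) (θ b″) ⇒ b″ = b` (`charpoly ∘ ι` injective near a regular torus point); (N3) FIBRE
EXHAUSTION `R a (θ b″) ⇒ ∃ j, stA a (τ_j b″)` for regular `a` (the norm fibre = the re-selections, F0P3a-p08's (J-d-2)); `R` invariant under `G′`-conjugation of its second argument;
(G1-i) `b ↦ Φ(⟦θ b⟧, ψ)` and (G1-ii) `b ↦ Δ(τ_j b, θ b)` locally constant on the box (F0P3a-p03 (ii)-CM dress, B-p04 (g33)); the `H`-side realisation package on each box (`hrealJ`, ★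
`IsCanonical.exists_isLocSmooth_stableOrbitalIntegralRel_eq_of_chart` at the chart datum of `w_j γH₀` — A-p16 (g26)); boxes pairwise stably separated (`hsepJ`); `Φ^st` additive (`hA`);
`Δ` stable-left-invariant (`hΔst`, ★ B-p10 p839998).  THEN (§1) on the box `RHS_ψ(τ_j b) = Δ(τ_j b, θ b) · Φ(⟦θ b⟧, ψ)` (the `G′`-chart support lemma ★ `exists_mem_mk_eq_of_classOrbitalIntegral_ne_zero` +
(N1) + `finsum_eq_single`), hence `RHS_ψ ∘ τ_j` is locally constant on the box and `RHS_ψ(a) = 0` at every regular `a` stably conjugate into no box ((N3)); so (§2) ★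
`exists_transfer_of_boxes_of_realisation` yields a Δ-transfer `ψ^H ∈ C_c^∞(H)` of `ψ`.

* §1 `finsum_delta_mul_classOrbitalIntegral_eq_of_matchedChart` (the box formula), `finsum_delta_mul_classOrbitalIntegral_eq_zero_of_forall_not_rel` (vanishing off the fibre boxes).
* §2 `exists_transfer_of_matchedChart` (THE MATCHED CHART).
* §3 `exists_transfer_of_unmatchedChart` (`ψ^H := 0` on a chart no element of which is matched — the `J = ∅` case with its own, simpler support hypothesis).

## References
* [Rogawski1990] J. Rogawski, *Automorphic Representations of Unitary Groups in Three Variables*, Ann. of Math. Stud. 123 (1990): §4.3 (4.3.1)–(4.3.2) pp. 42–43; §4.9 Prop. 4.9.1 (a) pp. 54–55;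
  §3.5–3.6 pp. 29–31 (stable classes in a torus, `𝔇(T∕F)`).
* [LanglandsShelstad1987] R. P. Langlands, D. Shelstad, *On the definition of transfer factors*, Math. Ann. 278 (1987): §1.3.
* [HarishChandra1970] Harish-Chandra (notes by G. van Dijk), LNM 162 (1970): Part I §3.
-/

set_option autoImplicit false

noncomputable section

open Set Filter Topology MeasureTheory
open scoped Pointwise

namespace Literature.NumberTheory.Rogawski1990

open Literature.NumberTheory.Automorphic

section Matched

variable {Acar : Type*} [Group Acar] [tA : TopologicalSpace Acar]
  [mA : ∀ γ : Acar, MeasurableSpace (Acar ⧸ Subgroup.centralizer ({γ} : Set Acar))]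
  {Bcar : Type*} [Group Bcar] [TopologicalSpace Bcar] [t2B : T2Space Bcar]
  [∀ b : Bcar, MeasurableSpace (Bcar ⧸ Subgroup.centralizer ({b} : Set Bcar))]
  {AG Tc : Type*} [TopologicalSpace AG] [TopologicalSpace Tc]

/-! ## §1 The right side of (4.3.1) on a matched chart -/

omit tA mA in
/-- **THE BOX FORMULA `RHS_ψ(τ_j b) = Δ(τ_j b, θ b) · Φ(⟦θ b⟧, ψ)`** for `ψ` vanishing off the `G′`-chart image `e_G(K_G × B_G)` (torus coordinate `θ`), under DIAGONAL MATCHING (N1)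
on the box and `G′`-conjugation invariance of `R` in the second slot: the only class with a non-zero term is `⟦θ b⟧` (★ `exists_mem_mk_eq_of_classOrbitalIntegral_ne_zero`, (N1),
★ `TransferFactorData.eq_zero_of_not_rel`, `conj_right`). [cite: Rogawski1990, §4.3 (4.3.1)–(4.3.2) pp. 42–43] -/
theorem finsum_delta_mul_classOrbitalIntegral_eq_of_matchedChart {R : Acar → Bcar → Prop} (T : TransferFactorData Acar Bcar R)
    (hRconj : ∀ (a : Acar) (γ y : Bcar), R a γ → R a (y * γ * y⁻¹)) (mG : OrbitalMeasureFamily Bcar)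
    (eG : OpenPartialHomeomorph (AG × Tc) Bcar) (sG : AG → Bcar) (θ : Tc → Bcar) (heG : ∀ p ∈ eG.source, eG p = sG p.1 * θ p.2 * (sG p.1)⁻¹)
    {KG : Set AG} (hKGc : IsCompact KG) {BG : Set Tc} (hBGc : IsCompact BG) (hKB : KG ×ˢ BG ⊆ eG.source)
    (τj : Tc → Acar) (hdiag : ∀ b ∈ BG, ∀ b'' ∈ BG, R (τj b) (θ b'') → b'' = b)
    {ψ : Bcar → ℂ} (hψ0 : ∀ y ∉ eG '' (KG ×ˢ BG), ψ y = 0) {b : Tc} (hb : b ∈ BG) :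
    ∑ᶠ c : ConjClasses Bcar, T.Δ (τj b) (Quotient.out c) * classOrbitalIntegral mG ψ c =
      T.Δ (τj b) (θ b) * classOrbitalIntegral mG ψ (ConjClasses.mk (θ b)) := by
  classical
  rw [finsum_eq_single _ (ConjClasses.mk (θ b))]
  · -- the main term: `out ⟦θ b⟧` is a conjugate of `θ b`
    obtain ⟨y, hy⟩ := isConj_iff.1 (ConjClasses.mk_eq_mk_iff_isConj.1 (Quotient.out_eq (ConjClasses.mk (θ b))).symm)
    rw [← hy, T.conj_right]
  · intro c hne
    by_cases hO : classOrbitalIntegral mG ψ c = 0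
    · rw [hO, mul_zero]
    obtain ⟨b'', hb'', rfl⟩ := exists_mem_mk_eq_of_classOrbitalIntegral_ne_zero mG eG sG θ heG hKGc hBGc hKB hψ0 hO
    by_cases hΔ : T.Δ (τj b) (Quotient.out (ConjClasses.mk (θ b''))) = 0
    · rw [hΔ, zero_mul]
    exfalso
    have hR : R (τj b) (Quotient.out (ConjClasses.mk (θ b''))) := not_imp_comm.1 (T.eq_zero_of_not_rel _ _) hΔ
    obtain ⟨y, hy⟩ := isConj_iff.1 (ConjClasses.mk_eq_mk_iff_isConj.1 (Quotient.out_eq (ConjClasses.mk (θ b''))))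
    have hR' : R (τj b) (θ b'') := by
      have := hRconj _ _ y hR
      rwa [hy] at this
    exact hne (by rw [hdiag b hb b'' hb'' hR'])

omit tA mA in
/-- **`RHS_ψ(a) = 0` at a regular `a` stably conjugate into NO re-selection box**, under FIBRE EXHAUSTION (N3): a non-zero term would give a class `⟦θ b″⟧`, `b″ ∈ B_G`, matched by
`a`, hence `stA a (τ_j b″)` for some `j`. [cite: Rogawski1990, §4.3 (4.3.2) p. 43; §3.6 p. 31] -/
theorem finsum_delta_mul_classOrbitalIntegral_eq_zero_of_forall_not_rel {R : Acar → Bcar → Prop} {stA : Acar → Acar → Prop} {regA : Acar → Prop}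
    (T : TransferFactorData Acar Bcar R) (hRconj : ∀ (a : Acar) (γ y : Bcar), R a γ → R a (y * γ * y⁻¹)) (mG : OrbitalMeasureFamily Bcar)
    (eG : OpenPartialHomeomorph (AG × Tc) Bcar) (sG : AG → Bcar) (θ : Tc → Bcar) (heG : ∀ p ∈ eG.source, eG p = sG p.1 * θ p.2 * (sG p.1)⁻¹)
    {KG : Set AG} (hKGc : IsCompact KG) {BG : Set Tc} (hBGc : IsCompact BG) (hKB : KG ×ˢ BG ⊆ eG.source)
    {J : Type*} (τ : J → Tc → Acar) (hfib : ∀ a, regA a → ∀ b'' ∈ BG, R a (θ b'') → ∃ j, stA a (τ j b''))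
    {ψ : Bcar → ℂ} (hψ0 : ∀ y ∉ eG '' (KG ×ˢ BG), ψ y = 0) {a : Acar} (ha : regA a) (hno : ∀ j, ∀ b ∈ BG, ¬ stA a (τ j b)) :
    ∑ᶠ c : ConjClasses Bcar, T.Δ a (Quotient.out c) * classOrbitalIntegral mG ψ c = 0 := by
  classical
  refine finsum_eq_zero_of_forall_eq_zero fun c => ?_
  by_cases hO : classOrbitalIntegral mG ψ c = 0
  · rw [hO, mul_zero]
  obtain ⟨b'', hb'', rfl⟩ := exists_mem_mk_eq_of_classOrbitalIntegral_ne_zero mG eG sG θ heG hKGc hBGc hKB hψ0 hO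
  by_cases hΔ : T.Δ a (Quotient.out (ConjClasses.mk (θ b''))) = 0
  · rw [hΔ, zero_mul]
  exfalso
  have hR : R a (Quotient.out (ConjClasses.mk (θ b''))) := not_imp_comm.1 (T.eq_zero_of_not_rel _ _) hΔ
  obtain ⟨y, hy⟩ := isConj_iff.1 (ConjClasses.mk_eq_mk_iff_isConj.1 (Quotient.out_eq (ConjClasses.mk (θ b''))))
  have hR' : R a (θ b'') := by
    have := hRconj _ _ y hR
    rwa [hy] at this
  obtain ⟨j, hj⟩ := hfib a ha b'' hb'' hR'
  exact hno j b'' hb'' hj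

/-! ## §2 THE MATCHED CHART -/

/-- **THE MATCHED CHART OF THE JUNCTION.**  `ψ ∈ C_c^∞(G′)` vanishing off the `G′`-chart image `e_G(K_G × B_G)` (torus coordinate `θ : Tc → G′`, `B_G` compact open AND closed in `Tc`);
re-selection maps `τ_j : Tc → H` (`j ∈ J` finite) at regular values on the box, pairwise stably separated (`hsepJ`), each with the `H`-side realisation package on the box `B_G` (`hrealJ`);
(N1) diagonal matching, (N3) fibre exhaustion, `R` conjugation-invariant on the right; (G1-i) `b ↦ Φ(⟦θ b⟧, ψ)` and (G1-ii) `b ↦ Δ(τ_j b, θ b)` locally constant at the points of `B_G`; `Φ^st`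
additive on `C_c^∞` at regular points; `Δ` stable-left-invariant.  Then `ψ` has a Δ-transfer `ψ^H ∈ C_c^∞(H)` (= `Σ_j f^H_j`, ★ `exists_transfer_of_boxes_of_realisation`).
[cite: Rogawski1990, §4.9 Prop. 4.9.1 (a) pp. 54–55; §4.3 (4.3.1)–(4.3.2) pp. 42–43] [cite: LanglandsShelstad1987, §1.3] -/
theorem exists_transfer_of_matchedChart {R : Acar → Bcar → Prop} {stA : Acar → Acar → Prop} {regA : Acar → Prop} {T : TransferFactorData Acar Bcar R}
    {mH : OrbitalMeasureFamily Acar} {mG : OrbitalMeasureFamily Bcar}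
    (hsymm : ∀ a a', stA a a' → stA a' a) (htrans : ∀ a a' a'', stA a a' → stA a' a'' → stA a a'')
    (hΔst : ∀ (a a' : Acar) (b : Bcar), stA a a' → T.Δ a' b = T.Δ a b) (hRconj : ∀ (a : Acar) (γ y : Bcar), R a γ → R a (y * γ * y⁻¹))
    (hA : ∀ a, regA a → ∀ F G : Acar → ℂ, IsLocSmooth F → IsLocSmooth G →
      stableOrbitalIntegralRel stA mH (F + G) a = stableOrbitalIntegralRel stA mH F a + stableOrbitalIntegralRel stA mH G a)
    -- the `G′`-chart with torus coordinate `θ`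
    (eG : OpenPartialHomeomorph (AG × Tc) Bcar) (sG : AG → Bcar) (θ : Tc → Bcar) (heG : ∀ p ∈ eG.source, eG p = sG p.1 * θ p.2 * (sG p.1)⁻¹)
    {KG : Set AG} (hKGc : IsCompact KG) {BG : Set Tc} (hBGc : IsCompact BG) (hBGo : IsOpen BG) (hBGcl : IsClosed BG) (hKB : KG ×ˢ BG ⊆ eG.source)
    -- the re-selection boxes on the `H`-side
    {J : Type*} [Fintype J] (τ : J → Tc → Acar) (hregτ : ∀ j, ∀ b ∈ BG, regA (τ j b))
    (hsepJ : ∀ j j', j ≠ j' → ∀ b ∈ BG, ∀ b' ∈ BG, ¬ stA (τ j b) (τ j' b'))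
    (hrealJ : ∀ j (g : Tc → ℂ), IsLocallyConstant g → ∃ fH : Acar → ℂ, IsLocSmooth fH ∧
      (∀ b ∈ BG, stableOrbitalIntegralRel stA mH fH (τ j b) = g b) ∧ ∀ a : Acar, (∀ b ∈ BG, ¬ stA a (τ j b)) → stableOrbitalIntegralRel stA mH fH a = 0)
    (hdiag : ∀ j, ∀ b ∈ BG, ∀ b'' ∈ BG, R (τ j b) (θ b'') → b'' = b)
    (hfib : ∀ a, regA a → ∀ b'' ∈ BG, R a (θ b'') → ∃ j, stA a (τ j b''))
    -- the function and the two local constancies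
    (ψ : Bcar → ℂ) (hψ0 : ∀ y ∉ eG '' (KG ×ˢ BG), ψ y = 0)
    (hOlc : ∀ b ∈ BG, ∀ᶠ b' in 𝓝 b, classOrbitalIntegral mG ψ (ConjClasses.mk (θ b')) = classOrbitalIntegral mG ψ (ConjClasses.mk (θ b)))
    (hΔlc : ∀ j, ∀ b ∈ BG, ∀ᶠ b' in 𝓝 b, T.Δ (τ j b') (θ b') = T.Δ (τ j b) (θ b)) :
    ∃ ψH : Acar → ℂ, IsLocSmooth ψH ∧ IsDeltaTransferRel R stA regA T mH mG ψH ψ := by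
  refine exists_transfer_of_boxes_of_realisation hsymm htrans hΔst hA τ (fun _ => BG) (fun _ => hBGo) (fun _ => hBGcl) hregτ hsepJ hrealJ ψ
    (fun j b hb => ?_) (fun a ha hno => ?_)
  · -- local constancy of `RHS_ψ ∘ τ_j` at the box point `b`, through the box formula
    filter_upwards [hOlc b hb, hΔlc j b hb, hBGo.mem_nhds hb] with b' hO' hΔ' hb'
    rw [finsum_delta_mul_classOrbitalIntegral_eq_of_matchedChart T hRconj mG eG sG θ heG hKGc hBGc hKB (τ j) (hdiag j) hψ0 hb',
      finsum_delta_mul_classOrbitalIntegral_eq_of_matchedChart T hRconj mG eG sG θ heG hKGc hBGc hKB (τ j) (hdiag j) hψ0 hb, hO', hΔ']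
  · exact finsum_delta_mul_classOrbitalIntegral_eq_zero_of_forall_not_rel T hRconj mG eG sG θ heG hKGc hBGc hKB τ hfib hψ0 ha hno

/-! ## §3 THE UNMATCHED CHART: `ψ^H := 0` -/

omit t2B in
/-- **THE UNMATCHED CHART OF THE JUNCTION**: if `ψ ∈ C_c^∞(G′)` is supported in an open set `U₀` NO element of which is matched (`∀ γ ∈ U₀, ∀ a, ¬ R a γ`; at CM: the regular classes
whose characteristic polynomial has no root `u(z)`, `z ∈ U(Φ₁)(L⁺_v)` — e.g. the cubic-field tori of `U(3)`), and `R` is invariant under `G′`-conjugation on the right, then `ψ^H := 0` is a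
Δ-transfer of `ψ`: every term `Δ(a, γ) Φ(⟦γ⟧, ψ)` vanishes (`Δ ≠ 0 ⇒ R a γ`; `Φ ≠ 0 ⇒` a conjugate of `γ` lies in `tsupport ψ ⊆ U₀`, ★ `classOrbitalIntegral_mk_eq_zero_of_forall_conj_notMem_tsupport`).
[cite: Rogawski1990, §4.3 (4.3.2) p. 43; §3.6 p. 31] -/
theorem exists_transfer_of_unmatchedChart {R : Acar → Bcar → Prop} {stA : Acar → Acar → Prop} {regA : Acar → Prop} (T : TransferFactorData Acar Bcar R)
    (hRconj : ∀ (a : Acar) (γ y : Bcar), R a γ → R a (y * γ * y⁻¹)) (mH : OrbitalMeasureFamily Acar) (mG : OrbitalMeasureFamily Bcar)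
    {U₀ : Set Bcar} (hU₀ : ∀ γ ∈ U₀, ∀ a : Acar, ¬ R a γ) {ψ : Bcar → ℂ} (hψ : tsupport ψ ⊆ U₀) :
    ∃ ψH : Acar → ℂ, IsLocSmooth ψH ∧ IsDeltaTransferRel R stA regA T mH mG ψH ψ := by
  classical
  refine ⟨0, isLocSmooth_zero, fun a _ => ?_⟩
  rw [stableOrbitalIntegralRel_zero]
  refine (finsum_eq_zero_of_forall_eq_zero fun c => ?_).symm
  by_cases hΔ : T.Δ a (Quotient.out c) = 0
  · rw [hΔ, zero_mul]
  have hR : R a (Quotient.out c) := not_imp_comm.1 (T.eq_zero_of_not_rel _ _) hΔ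
  rw [← Quotient.out_eq c, ConjClasses.quotient_mk_eq_mk,
    classOrbitalIntegral_mk_eq_zero_of_forall_conj_notMem_tsupport mG fun x hx => hU₀ _ (hψ hx) a ?_, mul_zero]
  exact hRconj _ _ x hR

end Matched

end Literature.NumberTheory.Rogawski1990

end
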